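import Summits.RiemannHypothesis.RiemannHypothesis.Theorems.TiltedLandingLaw421R3Lens1ArcSignM

/-!
# TiltedLandingLaw421R3 — lens-1 (part O): the TOOTH SPLIT of the tongue seal / gap-order law (class level, path-free)

LENS-1 gen-8 module image `rh33346-cover/lens-1/ToothSplit-v1.lean` (landing target `…/Theorems/TiltedLandingLaw421R3Lens1ArcSignO.lean`; ONE import =
part M `…R3Lens1ArcSignM`; a sibling of part N `PoleLink-v1`, not needed by it; checked BY CHAIN `lens-1/ToothSplit-v1-chain.lean` = the J ⊕ K ⊕ L ⊕ M
chain ⊕ this part over the tree parts A–I + `…R3NestedSign`).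

WHY (SUMMON (O8-1)).  Part Mʼs `TongueSealQ` can fail in two named ways: a TOOTH (a real zero of `G = f^{(j)}` on the tongueʼs axis contact, where
`Re φ` jumps upward) and a SECOND ARC.  The director asked for the tooth case to be split off BY NAME as an explicit residual (the W7 pattern), with a
PATH-FREE closed condition.  The honest path-free condition is CLASS-LEVEL: «no real zero of `f^{(j)}` in `a`ʼs closed Jensen interval
`[Re a − Im a, Re a + Im a]`» (`NoRealZero f j a`).  It is path-free and closed, and it is the right set: the tongue of radius excess `δ` lives in the
closed half-disc of radius `Im a + δ`, whose chord shrinks to the closed Jensen interval as `δ → 0`, and the real zeros of `f^{(j)} ≢ 0` near that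
interval are finitely many — so on the `NoRealZero` class every chord of `D_δ`, `δ` small, is tooth-free and part Mʼs two failure modes reduce to ONE
(second arc).  The finer per-gap condition the director sketched («no zero of `f^{(j)}` on the closed tongue region cut off by the chord `w₁w₂`») is NOT
typable path-free: the tongueʼs depth (`≤ 0.0586·Im a` adversarially, `0.024·Im a` in C6ʼs traces) can exceed the sagitta of the circular segment over
its own gap (`≈ 0.012·Im a` for a `17.6°` gap), so no disc- or chord-defined region is known to contain the tongueʼs axis contact; locating that contact
IS the nodal topology.  Recorded as UNDECIDED·IDEA-NEEDED, not typed.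

CONTENT.  §1 `NoRealZero`; the restricted laws ★ `TongueSealNRQ` (part Mʼs seal on the no-tooth class), `AtomicGapOrderLawNRQ` (part Lʼs gap order
on the no-tooth class), ★ `AtomicGapOrderLawToothQ` (the TOOTH RESIDUAL: gap order on the class WITH a real zero in the closed Jensen interval — by
C6 g37 0 / 247 360 tooth insertions broke ORDER, so the residual is conjecturally true by COMPENSATION along the walk, not by sealing) · §2 PROVED
bookkeeping: `tongueSealNR_of_tongueSeal`, `atomicGapOrderLawNR_of_tongueSealNR` (part Mʼs `re_le_of_sealingPath` pointwise), the restrictions of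
part Lʼs law to both classes, ★★ the glued split `atomicGapOrderLaw_of_toothSplit : AtomicGapOrderLawNRQ → AtomicGapOrderLawToothQ →
AtomicGapOrderLawQ` (exact, `by_cases`), and its corollaries down to `TopPinningNonNestedAscResidual` / `TopPinning` (with part Jʼs non-atomic
residual): `topPinningResidual_of_toothSplit`, `topPinning_of_toothSplit`, `topPinningResidual_of_sealNRSplit`.

HONEST LABEL / PRICE: typing + exact case split; no analysis.  After this part the atomic branch of the SEAL ladder reads
`TongueSealNRQ ⟹ AtomicGapOrderLawNRQ`, `+ AtomicGapOrderLawToothQ ⟹ AtomicGapOrderLawQ ⟹ AtomicNetLawQ ⟹ (RUNG 4) law on the atomic class`;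
`TongueSealNRQ` still carries the SECOND-ARC failure mode (global nodal topology; part Mʼs docstring), `AtomicGapOrderLawToothQ` carries the tooth
compensation; both OPEN, UNDECIDED.  Part N (`PoleLink-v1`) gives a tooth-free alternative for all cluster sizes.  `TopPinning`, 33346, 33347 OPEN;
nothing here bears on the truth of RH; RH is not proved; checked ≠ landed ≠ proved.
-/

noncomputable section

namespace RhW08.Lens1ArcSign

open Complex Set Metric Filter Topology
open scoped Real ComplexConjugate
open Literature.Topology.PlaneTopology Literature.Analysis.Complex
open Summit.RiemannHypothesis.RiemannHypothesis.Theorems.Splittings.JensenWindow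
open RhIdea6.G17.W07C7 RhIdea6.G17.W07C7.Rev6 RhIdea6.G18.W07C8.Law421BirthS RhIdea6.G19.W07C11.Seam
open RhIdea6.G20.W07C12.Frac RhIdea6.G20.W07C12.StColP RhW07.C12.FieldSplit RhIdea6.G21.W07C13.TentMax
open RhW07.C14.TwoSided RhW07.C14.Classes RhW07.C14.Lineage RhW07.C14.Booking
open RhW07.C13.Heredity RhIdea6.G22.W07C15pre.Injection RhW07.E3.Cell RhW07.E3.Lit
open RhW08.Round1 RhW08.StSwap RhW08.Round2 RhW08.QuadW RhW08.SealSwapQ RhW08.SealSwap RhW08.SuccB RhW08.SuccSplit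
open RhW08.SuccTheft RhW08.Column RhW08.Hurwitz RhW08.ClusterQ RhW08.ClusterQM RhW08.NewtonDoor RhW08.NewtonDoorGenusOne RhW08.PurseP
open RhW08.Lens1SignCut RhW08.Lens1Coverage RhW08.IsolatedTilt RhW08.Lens1Pinning RhW08.Lens1PinningIso

/-! ## §1 The no-tooth class and the restricted laws (statements) -/

/-- NO TOOTH: `f^{(j)}` has no REAL zero in `a`ʼs CLOSED Jensen interval `|x − Re a| ≤ Im a` (path-free, closed; module docstring). -/
def NoRealZero (f : ℂ → ℂ) (j : ℕ) (a : ℂ) : Prop :=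
  ∀ x : ℝ, |x - a.re| ≤ a.im → iteratedDeriv j f (x : ℂ) ≠ 0

/-- ★ THE TONGUE SEAL ON THE NO-TOOTH CLASS (OPEN): part Mʼs `TongueSealQ` with the extra binder `NoRealZero f j a`.  Remaining failure mode: the
tongue reaches a SECOND ARC of the circle (global nodal topology).  Weaker than `TongueSealQ`. -/
def TongueSealNRQ : Prop :=
  ∀ (η : ℝ) (f : ℂ → ℂ) (x₀ s hmax R Hs : ℝ) (B : ℕ), EngineHyps5 2 η f x₀ s hmax R Hs B → ∀ (j : ℕ) (a v : ℂ),
    iteratedDeriv j f a = 0 → 0 < a.im → NoTallerToucher f j a → Atomic f j a v →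
    iteratedDeriv (j + 1) f a ≠ 0 → iteratedDeriv (j + 1) f v ≠ 0 → NoRealZero f j a → ∃ d0 > 0, ∃ E : Set ℝ, E.Finite ∧ ∀ δ ∈ Ioo 0 d0 \ E,
      ∀ t₁ t₂ t₃ t₄ : ℝ, BadPiece f j a δ t₁ t₂ → BadPiece f j a δ t₃ t₄ → t₂ ≤ t₃ →
        (∀ t ∈ Icc t₂ t₃, (arcPhi f j a δ t).im ≤ 0) → SealingPath f j a δ t₂ t₃

/-- ★ GAP ORDER ON THE NO-TOOTH CLASS (OPEN): part Lʼs `AtomicGapOrderLawQ` with the extra binder `NoRealZero f j a`. -/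
def AtomicGapOrderLawNRQ : Prop :=
  ∀ (η : ℝ) (f : ℂ → ℂ) (x₀ s hmax R Hs : ℝ) (B : ℕ), EngineHyps5 2 η f x₀ s hmax R Hs B → ∀ (j : ℕ) (a v : ℂ),
    iteratedDeriv j f a = 0 → 0 < a.im → NoTallerToucher f j a → Atomic f j a v →
    iteratedDeriv (j + 1) f a ≠ 0 → iteratedDeriv (j + 1) f v ≠ 0 → NoRealZero f j a →
    ∃ d0 > 0, ∃ E : Set ℝ, E.Finite ∧ ∀ δ ∈ Ioo 0 d0 \ E, ArcGapOrder f j a δ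

/-- ★ THE TOOTH RESIDUAL (OPEN): part Lʼs gap order on the class WITH a real zero of `f^{(j)}` in the closed Jensen interval.  Conjecturally true by
COMPENSATION (the upward jump of `Re φ` at the tooth is repaid along the tongue walk; C6 g37: 0 / 247 360 tooth insertions broke ORDER), not by sealing. -/
def AtomicGapOrderLawToothQ : Prop :=
  ∀ (η : ℝ) (f : ℂ → ℂ) (x₀ s hmax R Hs : ℝ) (B : ℕ), EngineHyps5 2 η f x₀ s hmax R Hs B → ∀ (j : ℕ) (a v : ℂ),
    iteratedDeriv j f a = 0 → 0 < a.im → NoTallerToucher f j a → Atomic f j a v →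
    iteratedDeriv (j + 1) f a ≠ 0 → iteratedDeriv (j + 1) f v ≠ 0 → ¬ NoRealZero f j a →
    ∃ d0 > 0, ∃ E : Set ℝ, E.Finite ∧ ∀ δ ∈ Ioo 0 d0 \ E, ArcGapOrder f j a δ

/-! ## §2 Bookkeeping (PROVED): restrictions, seal ⇒ gap order on the class, the glued split, corollaries -/

/-- Part Mʼs seal restricts to the no-tooth class. -/
theorem tongueSealNR_of_tongueSeal (h : TongueSealQ) : TongueSealNRQ :=
  fun η f x₀ s hmax R Hs B hE j a v ha hapos hN hA hda hdv _ => h η f x₀ s hmax R Hs B hE j a v ha hapos hN hA hda hdv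

/-- Part Lʼs law restricts to the no-tooth class … -/
theorem atomicGapOrderLawNR_of_law (h : AtomicGapOrderLawQ) : AtomicGapOrderLawNRQ :=
  fun η f x₀ s hmax R Hs B hE j a v ha hapos hN hA hda hdv _ => h η f x₀ s hmax R Hs B hE j a v ha hapos hN hA hda hdv

/-- … and to the tooth class. -/
theorem atomicGapOrderLawTooth_of_law (h : AtomicGapOrderLawQ) : AtomicGapOrderLawToothQ :=
  fun η f x₀ s hmax R Hs B hE j a v ha hapos hN hA hda hdv _ => h η f x₀ s hmax R Hs B hE j a v ha hapos hN hA hda hdv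

/-- ★ SEAL ⇒ GAP ORDER on the no-tooth class (part Mʼs `re_le_of_sealingPath`, pointwise). -/
theorem atomicGapOrderLawNR_of_tongueSealNR (h : TongueSealNRQ) : AtomicGapOrderLawNRQ := by
  intro η f x₀ s hmax R Hs B hE j a v ha hapos hN hA hda hdv hT
  obtain ⟨d0, hd0, E, hEfin, hS⟩ := h η f x₀ s hmax R Hs B hE j a v ha hapos hN hA hda hdv hT
  have hGd : Differentiable ℂ (iteratedDeriv j f) := differentiable_iteratedDeriv_of_entire (realEntireLt2_of_hyps hE).diff j
  exact ⟨d0, hd0, E, hEfin, fun δ hδ t₁ t₂ t₃ t₄ h₁ h₂ h23 hgap => re_le_of_sealingPath hGd (hS δ hδ t₁ t₂ t₃ t₄ h₁ h₂ h23 hgap)⟩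

/-- ★★ THE GLUED TOOTH SPLIT (exact): `AtomicGapOrderLawNRQ → AtomicGapOrderLawToothQ → AtomicGapOrderLawQ`. -/
theorem atomicGapOrderLaw_of_toothSplit (hNR : AtomicGapOrderLawNRQ) (hT : AtomicGapOrderLawToothQ) : AtomicGapOrderLawQ := by
  intro η f x₀ s hmax R Hs B hE j a v ha hapos hN hA hda hdv
  by_cases h0 : NoRealZero f j a
  · exact hNR η f x₀ s hmax R Hs B hE j a v ha hapos hN hA hda hdv h0
  · exact hT η f x₀ s hmax R Hs B hE j a v ha hapos hN hA hda hdv h0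

/-- The split is exact: part Lʼs law is equivalent to the conjunction of its two restrictions. -/
theorem atomicGapOrderLaw_iff_toothSplit : AtomicGapOrderLawQ ↔ AtomicGapOrderLawNRQ ∧ AtomicGapOrderLawToothQ :=
  ⟨fun h => ⟨atomicGapOrderLawNR_of_law h, atomicGapOrderLawTooth_of_law h⟩, fun h => atomicGapOrderLaw_of_toothSplit h.1 h.2⟩

/-- ★★ … hence the SEAL on the no-tooth class + the tooth residual give part Lʼs law … -/
theorem atomicGapOrderLaw_of_sealNRSplit (h : TongueSealNRQ) (hT : AtomicGapOrderLawToothQ) : AtomicGapOrderLawQ :=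
  atomicGapOrderLaw_of_toothSplit (atomicGapOrderLawNR_of_tongueSealNR h) hT

/-- … part Iʼs residual (with part Jʼs non-atomic residual, via parts L/J) … -/
theorem topPinningResidual_of_toothSplit (hNR : AtomicGapOrderLawNRQ) (hT : AtomicGapOrderLawToothQ) (hR : NonAtomicTopResidualQ) :
    TopPinningNonNestedAscResidual :=
  topPinningResidual_of_gapOrderSplit (atomicGapOrderLaw_of_toothSplit hNR hT) hR

/-- … the same from the no-tooth SEAL … -/
theorem topPinningResidual_of_sealNRSplit (h : TongueSealNRQ) (hT : AtomicGapOrderLawToothQ) (hR : NonAtomicTopResidualQ) :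
    TopPinningNonNestedAscResidual :=
  topPinningResidual_of_toothSplit (atomicGapOrderLawNR_of_tongueSealNR h) hT hR

/-- … and `TopPinning`. -/
theorem topPinning_of_toothSplit (hNR : AtomicGapOrderLawNRQ) (hT : AtomicGapOrderLawToothQ) (hR : NonAtomicTopResidualQ) : TopPinning :=
  topPinning_of_nonNestedAscResidual (topPinningResidual_of_toothSplit hNR hT hR)

/-- Sanity: a no-tooth top has clean feet in the zero sense — the two feet of its Jensen circle are not zeros of `f^{(j)}`. -/
theorem feet_ne_zero_of_noRealZero {f : ℂ → ℂ} {j : ℕ} {a : ℂ} (h : NoRealZero f j a) (ha : 0 < a.im) :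
    iteratedDeriv j f ((a.re - a.im : ℝ) : ℂ) ≠ 0 ∧ iteratedDeriv j f ((a.re + a.im : ℝ) : ℂ) ≠ 0 :=
  ⟨h _ (by rw [show a.re - a.im - a.re = -a.im by ring, abs_neg, abs_of_pos ha]),
   h _ (by rw [show a.re + a.im - a.re = a.im by ring, abs_of_pos ha])⟩

end RhW08.Lens1ArcSign
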